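import Literature.Barriers.CriticalPhenomena.PlaquetteWalkHoleRootCutPocket
import Literature.Barriers.CriticalPhenomena.PlaquetteWalkHoleRootCutLawOver
import HarnessLib

/-!
# Barrier catalogue (SAWScalingLimit): THE POCKET LAW FOR OVER-WALKS

Leaf of `PlaquetteWalkHoleRootCutPocket` (the pocket law for under-walks: two live cut edges on different rhombi, the first the door
of a pocket avoiding the root and the far cell ⇒ no wound under-walk) and `PlaquetteWalkHoleRootCutLawOver` (transport of cut data
through the row mirror). Pockets reflect to pockets (`rowMirrorDom w P`), live doors to live doors:

★★★★★ `ΩG.WE_eq_excursionWinding_of_over_twoLive_cut_pocket` — hole absent; a cut `q 0 = (w.1, w.2 + 1), …, q K` (from the UPPER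
corner of the root edge) ending beyond the domain, edges neither the hole's `W` side nor the root edge, all dead except `i < k`; a set
of cells `P` with `w ∉ P`, `farW w ∉ P`, a face of the `i`-th edge in `P`, every live door of `P` the `i`-th or the `k`-th edge ⇒ no
wound class-`B2a` OVER-walk (first side `N`). With `faces_mem_rowMirrorDom_iff` (a face of the reflected edge lies in the reflected
pocket iff a face of the edge lies in the pocket).

Not in print; venture lane «pcv-sawmu», seat b-step0 gen 29 (FINDING-YB-KILL-FORCED-ZEROS §28).

References: A. Glazman, I. Manolescu, arXiv:1708.00395v3, §1 (Fig. 1–2), §2.1, §4.2 (lattice symmetries), Lemma 2.1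
[GlazmanManolescu2019]; A. Glazman, Electron. Commun. Probab. 20 (2015) no. 86, Lemma 3.1, proof pp. 6–7 [Glazman2015WeightedSAW];
R. Courant, H. Robbins, *What is Mathematics?* (1941/1958), Ch. V Appendix §2 (the even–odd rule) [CourantRobbins1958].
-/

noncomputable section

open Set Function Complex
open Literature.Topology.PlaneTopology

namespace Literature.Probability.RandomPlanarGeometry.SAW.YangBaxter

open Real
open Literature.Barriers.CriticalPhenomena.PlaquetteWalk (mirrorRow mirrorRowFace mirrorSide mirrorRow_side
  mirrorRowFace_mirrorRowFace mirrorRow_mirrorRow mirrorRow_injective)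

/-- **A face of the reflected edge lies in the reflected set iff a face of the edge lies in the set.**
[cite: GlazmanManolescu2019, §4.2 (lattice symmetries)] -/
theorem faces_mem_rowMirrorDom_iff (w : Face) (P : Set Face) (e : MidEdge) :
    ((mirrorRow w.2 e).faces.1 ∈ rowMirrorDom w P ∨ (mirrorRow w.2 e).faces.2 ∈ rowMirrorDom w P) ↔
      (e.faces.1 ∈ P ∨ e.faces.2 ∈ P) := by
  have h := faces_not_mem_rowMirrorDom_iff w Pᶜ e
  simp only [mem_rowMirrorDom, Set.mem_compl_iff, not_not] at h
  simp only [mem_rowMirrorDom]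
  exact h

namespace ΩG

variable {D : Set Face} {w : Face}

/-- The reflected side of a rhombus avoids the reflected side of another. [cite: GlazmanManolescu2019, §4.2 (lattice symmetries)] -/
private theorem mirror_side_nePO {g f : Face} {t x : Side} (h : g.side t ≠ f.side x) :
    (mirrorRowFace w.2 g).side (mirrorSide t) ≠ (mirrorRowFace w.2 f).side (mirrorSide x) := by
  rw [← mirrorRow_side, ← mirrorRow_side]; exact fun h' => h (mirrorRow_injective _ h')

/-- ★★★★★ **THE POCKET LAW FOR OVER-WALKS.** Hole absent; a lattice cut `q 0 = (w.1, w.2 + 1), …, q K` ending beyond the domain, edges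
neither the hole's `W` side nor the root edge, all dead except `i < k`; a set of cells `P` with `w ∉ P`, `farW w ∉ P`, a face of the
`i`-th edge in `P`, and every live door of `P` (a common side of a cell of `P ∩ D` and a cell of `D ∖ P`) equal to the `i`-th or the
`k`-th edge. Then every class-`B2a` OVER-walk (first side `N`) has its Yang–Baxter winding equal to the excursion winding — the
reflection of `WE_eq_excursionWinding_of_under_twoLive_cut_pocket`.
[cite: GlazmanManolescu2019, Lemma 2.1 (statement, "in the form given in [Gl]"), §1 (Fig. 1–2), §4.2 (lattice symmetries)]
[cite: Glazman2015WeightedSAW, Lemma 3.1 (proof, pp. 6–7)] [cite: CourantRobbins1958, Ch. V Appendix §2 (the even–odd rule)] -/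
theorem WE_eq_excursionWinding_of_over_twoLive_cut_pocket (hh : holeFaceW w ∉ D) {q : ℕ → ℤ × ℤ} {c : ℕ → Face}
    {s : ℕ → Side} {K : ℕ} (hq0 : q 0 = (w.1, w.2 + 1))
    (hseg : ∀ k, k < K → segment ℝ (toC (cornerPt (q k))) (toC (cornerPt (q (k + 1)))) = sideSeg (c k) (s k))
    (h1 : ∀ k, k < K → (c k).side (s k) ≠ (holeFaceW w).side .W) (h2 : ∀ k, k < K → (c k).side (s k) ≠ w.side .W)
    (hexit : (∀ f : Face, f ∈ D → f.1 < (q K).1) ∨ (∀ f : Face, f ∈ D → (q K).1 ≤ f.1) ∨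
      (∀ f : Face, f ∈ D → (q K).2 ≤ f.2) ∨ (∀ f : Face, f ∈ D → f.2 < (q K).2))
    {i k : ℕ} (hik : i < k)
    (hdead : ∀ k', k' < K → k' ≠ i → k' ≠ k →
      ((c k').side (s k')).faces.1 ∉ D ∨ ((c k').side (s k')).faces.2 ∉ D)
    {P : Set Face} (hwP : w ∉ P) (hfP : farW w ∉ P)
    (hiP : ((c i).side (s i)).faces.1 ∈ P ∨ ((c i).side (s i)).faces.2 ∈ P)
    (hdoor : ∀ g g' : Face, g ∈ P → g' ∉ P → g ∈ D → g' ∈ D → ∀ x x' : Side, g.side x = g'.side x' →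
      g.side x = (c i).side (s i) ∨ g.side x = (c k).side (s k))
    (ω : ΩG D (w.side .W) (farW w)) (hr : RootedFace D (w.side .W) (farW w)) (h : ω.IsB2a)
    (hN : ω.2.firstSideG = .N) (θ : ℝ) :
    ω.WE (fun _ => θ) = excursionWinding θ ω.2.firstSideG (ω.z1 hr h) ω.1 := by
  by_contra hW
  have hr' := rootedFace_rowMirrorDom w hr
  have h' := ω.mirrorFar_isB2a hr h
  have hh' : holeFaceW w ∉ rowMirrorDom w D := by rwa [mem_rowMirrorDom, mirrorRowFace_holeFaceW]
  have hS' : ω.mirrorFar.2.firstSideG = .S := by rw [mirrorFar_firstSideG, hN]; rfl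
  have hq0' : (((q 0).1, 2 * w.2 + 1 - (q 0).2) : ℤ × ℤ) = w := by rw [hq0]; exact Prod.ext rfl (by simp only; ring)
  have hwP' : w ∉ rowMirrorDom w P := by rwa [mem_rowMirrorDom, mirrorRowFace_self]
  have hfP' : farW w ∉ rowMirrorDom w P := by rwa [mem_rowMirrorDom, mirrorRowFace_farW]
  have hiP' := (faces_mem_rowMirrorDom_iff w P ((c i).side (s i))).2 hiP
  rw [mirrorRow_side] at hiP'
  refine absurd (WE_eq_excursionWinding_of_under_twoLive_cut_pocket (D := rowMirrorDom w D) hh'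
    (q := fun k => ((q k).1, 2 * w.2 + 1 - (q k).2)) (c := fun k => mirrorRowFace w.2 (c k))
    (s := fun k => mirrorSide (s k)) (K := K) hq0' (fun k hk => segment_cornerPt_reflect w (hseg k hk))
    (fun k hk => by have e := mirror_side_nePO (w := w) (h1 k hk); rwa [mirrorRowFace_holeFaceW] at e)
    (fun k hk => by have e := mirror_side_nePO (w := w) (h2 k hk); rwa [mirrorRowFace_self] at e)
    (beyond_rowMirrorDom_of_beyond w hexit) hik
    (fun k' hk' hi hk => by
      have e := (faces_not_mem_rowMirrorDom_iff w D ((c k').side (s k'))).2 (hdead k' hk' hi hk)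
      rwa [mirrorRow_side] at e)
    (P := rowMirrorDom w P) hwP' hfP' hiP' (fun g g' hg hg' hgD hg'D x x' e => ?_)
    ω.mirrorFar hr' h' hS' (π - θ)) (ω.mirrorFar_wound hr h hW)
  -- a live door of the reflected pocket reflects to a live door of the pocket
  rw [mem_rowMirrorDom] at hg hg' hgD hg'D
  have e' := congrArg (mirrorRow w.2) e
  rw [mirrorRow_side, mirrorRow_side] at e'
  have hd := hdoor _ _ hg hg' hgD hg'D _ _ e'
  rw [← mirrorRow_side] at hd
  rcases hd with hd | hd
  · left
    have := congrArg (mirrorRow w.2) hd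
    rwa [mirrorRow_mirrorRow, mirrorRow_side] at this
  · right
    have := congrArg (mirrorRow w.2) hd
    rwa [mirrorRow_mirrorRow, mirrorRow_side] at this

end ΩG

end Literature.Probability.RandomPlanarGeometry.SAW.YangBaxter
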